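import Summits.BirchSwinnertonDyer.Rank1Residual.WAll.TargetCMTwoRamifiedFamilies
import Summits.BirchSwinnertonDyer.Rank1Residual.P2.CornerFTwoPrintInterface
import Summits.BirchSwinnertonDyer.Rank1Residual.P2.TianFamilySevenAtTwo
import Summits.BirchSwinnertonDyer.Rank1Residual.P2.CongruentNumberPairsAtTwoGenusPointData
import Summits.BirchSwinnertonDyer.Rank1Residual.P2.CongruentNumberPairsAtTwoThreeFiveFamilyPrinted
import Literature.NumberTheory.EllipticCurves.Tian2014.ClassFiveFamilyDescentProofs
import HarnessLib

/-!
# Rung W-ALL (D-0120): ALT-CLOSERS BY NAME for the ramified slice of row 12₂ cut by the Tian–Yuan–Zhang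
# congruent-number families (`WAll/TargetCMTwoRamifiedFamilies.lean`) — file 1/2: the FLAG-FREE road LLT / T5 / T7 / M35 / TYZρ and the closer of the leaf
# `WAllCornerFTwoRamifiedTYZProved` (cell `bsd-print-cf2`, D-0131 (2) PRINT TIER, seat p1)

HONEST FRAMING (cell `bsd-print-cf2`, run/shared/lean/pub/bsd-print-cf2/; leaf «CornerF @ p = 2» =
`Summit.BirchSwinnertonDyer.WAllCornerFTwo`, OPEN AS A CLASS): NOTHING ASSERTED — no `def`, no
`@[conjecture]`, no named fact, no route file imported. This file restates, in the LEAF SHAPE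
`∀ W [IsElliptic] [IsGloballyMinimal], W.HasCM → W.analyticRank = 1 → ⟨W is a globally minimal model of a
member of the family⟩ → BSDp W 2`, explicit infinite families of quadratic twists
`E_m : y² = x³ − m²x` (CM by `ℤ[i]`, `2` ramified) on which the `2`-part of BSD is a KERNEL THEOREM modulo
named published facts, transporting the tree's per-model theorems (sub-lane «bsd-p2», Literature
`Tian2014/*`, `TianYuanZhang2017/*`, `LiLiuTian2024/*`) along `ℚ`-isomorphisms of globally minimal models
(FACT-FREE: ty2's interface `P2.CornerFTwo.CongruentNumber.bsdp_iff`, p534422 — `BSDp` is invariant under `ℚ`-isomorphism of globally minimal models). This file CLOSES the leaf `WAllCornerFTwoRamifiedTYZProved` of `WAll/TargetCMTwoRamifiedFamilies.lean`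
(`wAllCornerFTwoRamifiedTYZProved_of_facts`, binders TYZ17 Thm 1.2′ / Tian14 Thm 1.3 / Rédei–Reichardt /
LLT24 Thm 1.2 / Monsky90 Cor 5.15 (2) / GZK); the U⁺-road families (T6, TYZ-U⁺, A37), the FJ atlas and their
closers are in file 2/2 (`WAll/AltClosersCMTwoRamifiedGenusClass.lean`). Strategy sentence of the seat (p1): «Tian–Yuan–Zhang
induction BY NAME: Heegner points + genus theory + Gross–Zagier/Waldspurger ⇒ 2-part of BSD for `E_n` with
controlled prime factorisations, typed as class theorems on explicit infinite families». Cell referee's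
pre-landing verdict (HOME STATUS 2026-08-27T12:49:43Z): LLT PASS (beyond print NO), T5 PASS (NO), T7 PASS
PROVED-by-name (YES), M35 PASS PROVED-by-name (YES), TYZρ PASS PROVED-by-name (YES).

| slice theorem | family (`pᵢ` distinct primes, `G` = Legendre graph in Monsky's kernel form `hG`) | named facts | BSD₂ in print? |
|---|---|---|---|
| `cornerFTwo_congruentFamilyLLT` | `E_n`, `n ≡ 5 (8)` square-free, all `q ∣ n` `≡ 1 (4)`, no ideal class of order `4` | LLT24 Thm 1.2 | YES (full BSD) |
| `cornerFTwo_tianClassFive` | `E_n`, `n = ∏ pᵢ ≡ 5 (8)`, all `pᵢ ≡ 1 (4)`, `G` odd | LLT24 Thm 1.2, Rédei–Reichardt | YES (LLT + RR evaluation) |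
| `cornerFTwo_tianClassSeven` | `E_n`, `p₀ ≡ 7`, `pᵢ ≡ 1 (8)`, `G` odd (Tian 2014 class 7) | TYZ17 Thm 1.2′, Tian14 Thm 1.3, RR | NO — beyond print |
| `cornerFTwo_threeFive` | `E_{pq}`, `p ≡ 3`, `q ≡ 5 (8)` | TYZ17 Thm 1.2′, Monsky90 Cor 5.15 (2), RR | NO — beyond print |
| `cornerFTwo_tyzGenusRho` | square-free `n ≡ 5, 7 (8)`, `#Sel₂(E_n) = 8`, `ρ(n) = 0`, `Σ₁ ∨ Σ₂′` odd (TYZ Thm 1.2 / ICM Thm 13 as a CLASS) | TYZ17 Thm 1.2′, GZK | NO — beyond print (assembly) |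

References: [Tian2014] Thm 1.3, Lemma 5.1, Rem 1.4; [TianYuanZhang2017] Thm 1.2, §3; [LiLiuTian2024] Thm 1.2;
[Tian2023CongruentICM] Thm 2, p. 1993, Thm 8 / 13; [Monsky1990MockHeegner] Cor 5.15; [Miller2011LMS] Def 1.1;
[Cassels1965ArithmeticVIII]; tree files cited inline.
-/

noncomputable section

open scoped Classical

open Matrix WeierstrassCurve Literature.NumberTheory.EllipticCurves
  Literature.NumberTheory.EllipticCurves.Rank1Residual
  Literature.NumberTheory.EllipticCurves.HeathBrown1994
  Literature.NumberTheory.EllipticCurves.TianYuanZhang2017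
  Literature.NumberTheory.EllipticCurves.Tian2014
  Literature.NumberTheory.EllipticCurves.LiLiuTian2024
  Literature.NumberTheory.EllipticCurves.Monsky1990
  Literature.NumberTheory.QuadraticFields.RedeiReichardt
  Summit.BirchSwinnertonDyer.Rank1Residual

set_option autoImplicit false

namespace Summit.BirchSwinnertonDyer.Rank1Residual.WAll.PrintCf2

/-! ## §1 Transport along `ℚ`-isomorphisms of globally minimal models: FACT-FREE (ty2's interface
`P2.CornerFTwo.CongruentNumber.*`, p534422: `bsdp_iff`, `analyticRank_eq`, `hasCM`, `cmRamified_two`) — no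
Cassels / GZK / modularity binder is displayed for the transport anywhere below. -/

/-! ## §2 The Li–Liu–Tian 2024 family (PRINT: full BSD) as a slice of the leaf -/

/-- **SLICE LLT (in print).** Every globally minimal model `W` of `E_n : y² = x³ − n²x` with `n` square-free,
`n ≡ 5 (mod 8)`, all prime factors `≡ 1 (mod 4)` and no ideal class of order `4` in `ℚ(√−n)` — the printed
hypotheses of Li–Liu–Tian 2024 Thm 1.2 (`hLLT`, full BSD) — satisfies `BSD(W, 2)`; stated in the shape of the
leaf `WAllCornerFTwo` (the hypotheses `W.HasCM`, `W.analyticRank = 1` are those of the leaf and are not used).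
This is ty2's `P2.CornerFTwo.forall_bsdp_of_congruentFamilyLLT` read on the leaf; ONE displayed fact. Beyond print: NO.
[cite: LiLiuTian2024, Thm. 1.2 (arXiv:1605.01481 §1, p. 2)] [cite: Tian2023CongruentICM, Thm. 2 (p. 1993)]
[cite: Miller2011LMS, Def. 1.1] -/
theorem cornerFTwo_congruentFamilyLLT (hLLT : thm12_bsd_congruentNumberCurve) :
    ∀ (W : WeierstrassCurve ℚ) [W.IsElliptic] [W.IsGloballyMinimal], W.HasCM → W.analyticRank = 1 →
      P2.CongruentFamilyLLT W → BSDp W 2 :=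
  fun W _ _ _ _ hW => P2.CornerFTwo.forall_bsdp_of_congruentFamilyLLT hLLT W hW 2 Nat.prime_two

/-- **Membership (LLT).** Every globally minimal model of a member of the Li–Liu–Tian family is a point of the
leaf: CM and analytic rank one (the rank from `hLLT`). [cite: LiLiuTian2024, Thm. 1.2] -/
theorem hasCM_and_analyticRank_eq_one_of_congruentFamilyLLT (hLLT : thm12_bsd_congruentNumberCurve)
    (W : WeierstrassCurve ℚ) [W.IsElliptic] [W.IsGloballyMinimal] (hW : P2.CongruentFamilyLLT W) :
    W.HasCM ∧ W.analyticRank = 1 :=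
  let h := P2.cornerFSharp_of_congruentFamilyLLT hLLT W hW
  ⟨h.1, h.2.2.1⟩

/-! ## §3 Tian's class-`5` graph family (PRINT via Li–Liu–Tian + Rédei–Reichardt) -/

/-- **SLICE T5 (in print).** For distinct primes `p₀, …, p_k`, all `≡ 1 (mod 4)`, with `n = ∏ pᵢ ≡ 5 (mod 8)`
and ODD Legendre graph (Monsky's kernel form `hG`), every globally minimal model `W` of `E_n` satisfies
`BSD(W, 2)` — Li–Liu–Tian 2024 Thm 1.2 (`hLLT`) with its class-group hypothesis evaluated by Rédei–Reichardt
(`hR`; tree `Tian2014.forall_bsdp_congruentNumberCurve_caseFive`), transported fact-free. Contains Tian 2014's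
class-`5` family (`p₀ ≡ 5`, `pᵢ ≡ 1 (mod 8)`, condition (1.1) ⟺ `G` odd, Lemma 5.1). Beyond print: NO.
[cite: LiLiuTian2024, Thm. 1.2] [cite: Tian2014, Thm. 1.3 and Lemma 5.1 (arXiv p. 2, p. 28)] [cite: LiMa2008, Thm. 0.4 (p. 280)]
[cite: Miller2011LMS, Def. 1.1] -/
theorem cornerFTwo_tianClassFive (hLLT : thm12_bsd_congruentNumberCurve)
    (hR : redeiReichardt_fourTwoCard_classGroup) :
    ∀ (W : WeierstrassCurve ℚ) [W.IsElliptic] [W.IsGloballyMinimal], W.HasCM → W.analyticRank = 1 →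
      ∀ (k : ℕ) (p : Fin (k + 1) → ℕ), (∀ i, (p i).Prime) → Function.Injective p → (∀ i, p i % 4 = 1) →
        (∏ i, p i) % 8 = 5 → (∀ v, legendreMatrix p *ᵥ v = 0 → v = 0 ∨ v = fun _ => 1) →
        ∀ (C : VariableChange ℚ), C • congruentNumberCurve (∏ i, p i) = W → BSDp W 2 := by
  intro W _ _ _ _ k p hp hinj h4 h5 hG C hC
  have hsq : Squarefree (∏ i, p i) := squarefree_prod_of_injective p hp hinj
  haveI := isElliptic_congruentNumberCurve hsq.ne_zero
  haveI := isGloballyMinimal_congruentNumberCurve hsq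
  refine (P2.CornerFTwo.CongruentNumber.analyticRank_eq_one_and_bsdp_two_of_smul hsq ⟨?_, ?_⟩ hC).2
  · exact (bsd_congruentNumberCurve_caseFive p hR hLLT hp hinj h4 h5 hG rfl).2.1
  · exact forall_bsdp_congruentNumberCurve_caseFive p hR hLLT hp hinj h4 h5 hG rfl 2 Nat.prime_two

/-- **Membership (T5).** Every globally minimal model of a class-`5` graph-family twist is a point of the
leaf: CM, analytic rank one (rank from `hLLT` + `hR`). [cite: LiLiuTian2024, Thm. 1.2] [cite: LiMa2008, Thm. 0.4 (p. 280)] -/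
theorem hasCM_and_analyticRank_eq_one_of_tianClassFive (hLLT : thm12_bsd_congruentNumberCurve)
    (hR : redeiReichardt_fourTwoCard_classGroup)
    {k : ℕ} (p : Fin (k + 1) → ℕ) (hp : ∀ i, (p i).Prime) (hinj : Function.Injective p)
    (h4 : ∀ i, p i % 4 = 1) (h5 : (∏ i, p i) % 8 = 5)
    (hG : ∀ v, legendreMatrix p *ᵥ v = 0 → v = 0 ∨ v = fun _ => 1)
    {W : WeierstrassCurve ℚ} [W.IsElliptic] [W.IsGloballyMinimal] {C : VariableChange ℚ}
    (hC : C • congruentNumberCurve (∏ i, p i) = W) : W.HasCM ∧ W.analyticRank = 1 := by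
  have hsq : Squarefree (∏ i, p i) := squarefree_prod_of_injective p hp hinj
  haveI := isElliptic_congruentNumberCurve hsq.ne_zero
  haveI := isGloballyMinimal_congruentNumberCurve hsq
  have hiso : IsIsogenous W (congruentNumberCurve (∏ i, p i)) := by
    rw [← hC]; exact isIsogenous_of_smul _ C
  exact ⟨P2.CornerFTwo.CongruentNumber.hasCM hsq.ne_zero ⟨C, hC⟩,
    by rw [analyticRank_eq_of_isIsogenous' hiso]
       exact (bsd_congruentNumberCurve_caseFive p hR hLLT hp hinj h4 h5 hG rfl).2.1⟩

/-! ## §4 Tian's class-`7` family (BEYOND PRINT: TYZ Thm 1.2 + Tian Thm 1.3 + Rédei–Reichardt) -/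

/-- **SLICE T7 (beyond print, kernel theorem of «bsd-p2»).** For distinct primes `p₀ ≡ 7`, `pᵢ ≡ 1 (mod 8)`
(`i ≥ 1`) with ODD Legendre graph (`hG`; Tian 2014 Lemma 5.1: ⟺ condition (1.1) on `Cl(ℚ(√−2n))`) and
`n = ∏ pᵢ`, every globally minimal model `W` of `E_n` satisfies `BSD(W, 2)`. Inputs BY NAME: Tian–Yuan–Zhang
2017 Thm 1.2 as printed (`h12`: the parity of `𝓛(n)` from genus periods / the Gross–Zagier–Waldspurger
induction), Tian 2014 Thm 1.3 (`h13`: Heegner point ⇒ rank `1 = ord`, `Ш` finite ODD), Rédei–Reichardt (`hR`)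
— nothing else (the model transport is fact-free); the `2`-adic bridge (`#E_n(ℚ)_tor = 4`, `∏c_ℓ = 2^{2k+1}`,
`Ω(E_n) = Ω_{n,∞}`, `ρ(n) = 0`, `Σ₁(n)` odd) is PROVED in the tree (`P2.forall_bsdp_two_congruentNumberCurve_caseSeven'`).
The `2`-part of BSD on this family is NOT a printed theorem (Tian 2014 Rem. 1.4). Beyond print: YES.
[cite: Tian2014, Thm. 1.3, Lemma 5.1, Rem. 1.4 (arXiv:1210.8231 p. 2, p. 28)] [cite: TianYuanZhang2017, Thm. 1.2 (arXiv:1411.4728 §1)]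
[cite: LiMa2008, Thm. 0.4 (p. 280)] [cite: Miller2011LMS, Def. 1.1] -/
theorem cornerFTwo_tianClassSeven (h12 : thm12_parity_of_scriptL') (h13 : thm13_rank_one_and_sha_odd)
    (hR : redeiReichardt_fourTwoCard_classGroup) :
    ∀ (W : WeierstrassCurve ℚ) [W.IsElliptic] [W.IsGloballyMinimal], W.HasCM → W.analyticRank = 1 →
      ∀ (k : ℕ) (p : Fin (k + 1) → ℕ), (∀ i, (p i).Prime) → Function.Injective p → p 0 % 8 = 7 →
        (∀ i, i ≠ 0 → p i % 8 = 1) → (∀ v, legendreMatrix p *ᵥ v = 0 → v = 0 ∨ v = fun _ => 1) →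
        ∀ (C : VariableChange ℚ), C • congruentNumberCurve (∏ i, p i) = W → BSDp W 2 := by
  intro W _ _ _ _ k p hp hinj h7 h1 hG C hC
  have hsq : Squarefree (∏ i, p i) := squarefree_prod_of_injective p hp hinj
  have h := P2.bsdp_two_congruentNumberCurve_caseSeven_of_thm13' p h12 h13 hR hp hinj h7 h1 hG rfl
  exact (P2.CornerFTwo.CongruentNumber.analyticRank_eq_one_and_bsdp_two_of_smul hsq
    ⟨h.2.1, h.2.2.2.2⟩ hC).2

/-- **Membership (T7).** Every globally minimal model of a class-`7` family twist is a point of the leaf: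
CM, analytic rank one (rank from Tian 2014 Thm 1.3 `h13` + `hR`). [cite: Tian2014, Thm. 1.3 with Lemma 5.1]
[cite: LiMa2008, Thm. 0.4 (p. 280)] -/
theorem hasCM_and_analyticRank_eq_one_of_tianClassSeven (h13 : thm13_rank_one_and_sha_odd)
    (hR : redeiReichardt_fourTwoCard_classGroup)
    {k : ℕ} (p : Fin (k + 1) → ℕ) (hp : ∀ i, (p i).Prime) (hinj : Function.Injective p)
    (h7 : p 0 % 8 = 7) (h1 : ∀ i, i ≠ 0 → p i % 8 = 1)
    (hG : ∀ v, legendreMatrix p *ᵥ v = 0 → v = 0 ∨ v = fun _ => 1)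
    {W : WeierstrassCurve ℚ} [W.IsElliptic] [W.IsGloballyMinimal] {C : VariableChange ℚ}
    (hC : C • congruentNumberCurve (∏ i, p i) = W) : W.HasCM ∧ W.analyticRank = 1 := by
  have hsq : Squarefree (∏ i, p i) := squarefree_prod_of_injective p hp hinj
  haveI := isElliptic_congruentNumberCurve hsq.ne_zero
  haveI := isGloballyMinimal_congruentNumberCurve hsq
  have hiso : IsIsogenous W (congruentNumberCurve (∏ i, p i)) := by
    rw [← hC]; exact isIsogenous_of_smul _ C
  exact ⟨P2.CornerFTwo.CongruentNumber.hasCM hsq.ne_zero ⟨C, hC⟩,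
    by rw [analyticRank_eq_of_isIsogenous' hiso]
       exact (thm13_caseSeven p h13 hR hp hinj h7 h1 hG rfl).2.1⟩

/-! ## §5b The two-prime family `p₃·q₅` (BEYOND PRINT: TYZ Thm 1.2 + Monsky 1990 Cor 5.15 (2) + Rédei–Reichardt) -/

/-- **SLICE M35 (beyond print, kernel theorem of «bsd-p2»).** For primes `p ≡ 3`, `q ≡ 5 (mod 8)` (so
`pq ≡ 7 (mod 8)`; a family OUTSIDE Tian 2014 Thm 1.3, two prime factors `≢ 1 (mod 8)`), every globally
minimal model `W` of `E_{pq}` satisfies `BSD(W, 2)`. Inputs BY NAME: Tian–Yuan–Zhang 2017 Thm 1.2 as printed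
(`h12`; the printed genus condition "`Σ₁` odd or `Σ₂′` odd" holds uniformly), Monsky 1990 Cor 5.15 (2)
(`h515`: rank one and the `2`-Selmer count), Rédei–Reichardt (`hR`) — nothing else
(`P2.bsdp_two_congruentNumberCurve_three_five'` + fact-free transport). Beyond print: YES (rank one is Monsky's; the
`2`-part is in no held print). [cite: TianYuanZhang2017, Thm. 1.2 and §1 (1.1)] [cite: Monsky1990MockHeegner, Cor. 5.15 (2) (p. 66)]
[cite: LiMa2008, Thm. 0.4 (p. 280)] [cite: Miller2011LMS, Def. 1.1] -/
theorem cornerFTwo_threeFive (h12 : thm12_parity_of_scriptL') (hR : redeiReichardt_fourTwoCard_classGroup)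
    (h515 : cor515_rank_eq_one_and_card_selmerGroup_two) :
    ∀ (W : WeierstrassCurve ℚ) [W.IsElliptic] [W.IsGloballyMinimal], W.HasCM → W.analyticRank = 1 →
      ∀ (p q : ℕ), p.Prime → q.Prime → p % 8 = 3 → q % 8 = 5 →
        ∀ (C : VariableChange ℚ), C • congruentNumberCurve (p * q) = W → BSDp W 2 := by
  intro W _ _ _ _ p q hp hq hp3 hq5 C hC
  have hsq : Squarefree (p * q) := by
    rw [Nat.squarefree_mul ((Nat.coprime_primes hp hq).mpr (fun h => by omega))]
    exact ⟨hp.squarefree, hq.squarefree⟩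
  exact (P2.CornerFTwo.CongruentNumber.analyticRank_eq_one_and_bsdp_two_of_smul hsq
    (P2.bsdp_two_congruentNumberCurve_three_five' h12 hR h515 hp hq hp3 hq5) hC).2

/-- **Membership (M35).** Every globally minimal model of `E_{pq}` (`p ≡ 3`, `q ≡ 5 (mod 8)`) is a point of
the leaf: CM, analytic rank one (the rank from `h12` + `hR` + `h515`). [cite: TianYuanZhang2017, Thm. 1.2]
[cite: Monsky1990MockHeegner, Cor. 5.15 (2) (p. 66)] -/
theorem hasCM_and_analyticRank_eq_one_of_threeFive (h12 : thm12_parity_of_scriptL')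
    (hR : redeiReichardt_fourTwoCard_classGroup) (h515 : cor515_rank_eq_one_and_card_selmerGroup_two)
    {p q : ℕ} (hp : p.Prime) (hq : q.Prime) (hp3 : p % 8 = 3) (hq5 : q % 8 = 5)
    {W : WeierstrassCurve ℚ} [W.IsElliptic] [W.IsGloballyMinimal] {C : VariableChange ℚ}
    (hC : C • congruentNumberCurve (p * q) = W) : W.HasCM ∧ W.analyticRank = 1 := by
  have hsq : Squarefree (p * q) := by
    rw [Nat.squarefree_mul ((Nat.coprime_primes hp hq).mpr (fun h => by omega))]
    exact ⟨hp.squarefree, hq.squarefree⟩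
  haveI := isElliptic_congruentNumberCurve hsq.ne_zero
  haveI := isGloballyMinimal_congruentNumberCurve hsq
  have hiso : IsIsogenous W (congruentNumberCurve (p * q)) := by
    rw [← hC]; exact isIsogenous_of_smul _ C
  exact ⟨P2.CornerFTwo.CongruentNumber.hasCM hsq.ne_zero ⟨C, hC⟩,
    by rw [analyticRank_eq_of_isIsogenous' hiso]
       exact (P2.bsdp_two_congruentNumberCurve_three_five' h12 hR h515 hp hq hp3 hq5).1⟩

/-! ## §7 The TYZ GENUS CLASSES (tuple-free; maximal print reach): Tian–Yuan–Zhang Thm 1.2 / ICM Thm 13 BY NAME -/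

/-- The `2`-adic bookkeeping of the bridge on `E_n`, tuple-free: `2k(n) − 2 − a(n) = ord₂ ∏c_ℓ(E_n) − 4`
(`∏c_ℓ = 2^{2k+2−a}`, lit-1's Tamagawa theorem; `#E_n(ℚ)_tor² = 16`).
[cite: TianYuanZhang2017, §1 (p0002 L51–L75: k(n), a(n), (1.1))] [cite: SilvermanATAEC1994, IV.9 Table 4.1] -/
theorem twoExponent_eq_padicValNat_tamagawaProduct_sub_four {n : ℕ} (hsq : Squarefree n) :
    haveI := isElliptic_congruentNumberCurve hsq.ne_zero
    twoExponent n = (padicValNat 2 (congruentNumberCurve n).tamagawaProduct : ℤ) - 4 := by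
  rw [padicValNat_two_tamagawaProduct_congruentNumberCurve hsq, twoExponent, oddPrimeFactorCount,
    oddIndicator]
  split_ifs <;> push_cast <;> omega

/-- **THE TYZ GENUS CLASS AT `ρ = 0` (classes `5`, `7`), tuple-free.** For square-free `n ≡ 5, 7 (mod 8)`
with `#Sel₂(E_n) = 8` (i.e. `s(n) = 1`, Tian's set `Σ′`), `ρ(n) = 0` (`[E_n(ℚ) : φ_n(A_n(ℚ)) + E_n[2]] = 1`)
and an ODD genus sum (`Σ₁(n)` or `Σ₂′(n)` over `K_d = GenusField d`; Tian's set `Σ″`, ICM 2022 Thm 13):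
`ord_{s=1} L(E_n, s) = 1`, rank `E_n(ℚ) = 1`, `Ш(E_n)[2^∞] = 0` and **`BSD(E_n, 2)`** — modulo exactly
Tian–Yuan–Zhang 2017 Thm 1.2 AS PRINTED (`h12`) and Gross–Zagier–Kolyvagin (`hGZK`); the bridge
(`#tor = 4`, `ord₂ ∏c_ℓ = 2k + 2 − a`, `Ω = Ω_{n,∞}`) is PROVED in the tree. This is the per-`n` content of
Tian's ICM survey Thm 8 ("density-`2/3` subset of `S` … the `2`-part BSD formula holds") with its unprinted
step `ρ(n) = 0` kept as a hypothesis (p2-lit-1 T1-M15). Tuple-free twin of «bsd-p2»'s door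
`P2.bsdp_two_congruentNumberCurve_iff_of_genus'`. Beyond print: YES (assembly); inputs PUB.
[cite: TianYuanZhang2017, Thm. 1.2 and §1 (1.1) (arXiv:1411.4728 p0002)] [cite: Tian2023CongruentICM, Thm. 8 (p. 1996), Thm. 13 (p. 2000–2001)]
[cite: SilvermanAEC2009, Thm. X.4.2] [cite: Miller2011LMS, Def. 1.1 (arXiv:1010.2431 p. 3)] -/
theorem rankOne_sha_bsdp_two_congruentNumberCurve_of_tyzGenus (h12 : thm12_parity_of_scriptL')
    (hGZK : rank_eq_analyticRank_of_analyticRank_le_one) {n : ℕ} (hsq : Squarefree n)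
    (h8 : n % 8 = 5 ∨ n % 8 = 7)
    (hsel : haveI := isElliptic_congruentNumberCurve hsq.ne_zero;
      Nat.card ((congruentNumberCurve n).selmerGroup 2) = 8)
    (hρ : (rhoSubgroup n).index = 1)
    (hgen : Odd (genusSum₁ n fun d => genusClassNumber (GenusField d)) ∨
      Odd (genusSum₂' n fun d => genusClassNumber (GenusField d))) :
    haveI := isElliptic_congruentNumberCurve hsq.ne_zero
    (congruentNumberCurve n).analyticRank = 1 ∧ (congruentNumberCurve n).mordellWeilRank = 1 ∧
      AddCommGroup.primaryComponent (congruentNumberCurve n).sha 2 = ⊥ ∧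
      BSDp (congruentNumberCurve n) 2 := by
  haveI := isElliptic_congruentNumberCurve hsq.ne_zero
  haveI : Fact (Nat.Prime 2) := ⟨Nat.prime_two⟩
  obtain ⟨Lz, hLodd, hr1, hderiv⟩ :=
    rankOneDatum_of_index_eq_one' h12 hsq h8 hρ GenusField (isGenusFieldFamily_genusField n) hgen
  have hx : deriv (congruentNumberCurve n).entireLFunction 1 =
      (((2 : ℚ) ^ twoExponent n * (Lz : ℚ) ^ 2 : ℚ) : ℂ) *
        ((congruentNumberCurve n).realPeriodRat : ℂ) * ((congruentNumberCurve n).regulator : ℂ) := by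
    rw [hderiv]; push_cast; ring
  obtain ⟨hrank, -⟩ := hGZK (congruentNumberCurve n) (le_of_eq hr1)
  rw [hr1] at hrank
  have hbot := P2.primaryComponent_sha_two_eq_bot_of_card_selmerGroup_eq_eight hsq.ne_zero hrank hsel
  refine ⟨hr1, hrank, hbot, ?_⟩
  rw [P2.bsdp_two_iff_of_LDerivOverOmegaReg_of_sha_two_eq_bot_of_torsionOrder_eq_four
    (congruentNumberCurve n) hGZK hr1 hx hbot (torsionOrder_congruentNumberCurve hsq),
    P2.padicValRat_two_zpow_mul_sq hLodd, twoExponent_eq_padicValNat_tamagawaProduct_sub_four hsq]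

/-- **SLICE TYZ-ρ (leaf shape).** Every globally minimal model `W` of a member `E_n` of the TYZ genus class
at `ρ = 0` (square-free `n ≡ 5, 7 (mod 8)`, `#Sel₂(E_n) = 8`, `ρ(n) = 0`, `Σ₁` or `Σ₂′` odd) satisfies
`BSD(W, 2)`, modulo `h12` (TYZ Thm 1.2 as printed) and `hGZK` only (fact-free transport). Beyond print: YES.
[cite: TianYuanZhang2017, Thm. 1.2] [cite: Tian2023CongruentICM, Thm. 8 and Thm. 13] [cite: Miller2011LMS, Def. 1.1] -/
theorem cornerFTwo_tyzGenusRho (h12 : thm12_parity_of_scriptL')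
    (hGZK : rank_eq_analyticRank_of_analyticRank_le_one) :
    ∀ (W : WeierstrassCurve ℚ) [W.IsElliptic] [W.IsGloballyMinimal], W.HasCM → W.analyticRank = 1 →
      ∀ (n : ℕ) (hsq : Squarefree n), (n % 8 = 5 ∨ n % 8 = 7) →
        (haveI := isElliptic_congruentNumberCurve hsq.ne_zero;
          Nat.card ((congruentNumberCurve n).selmerGroup 2) = 8) →
        (rhoSubgroup n).index = 1 →
        (Odd (genusSum₁ n fun d => genusClassNumber (GenusField d)) ∨
          Odd (genusSum₂' n fun d => genusClassNumber (GenusField d))) →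
        ∀ (C : VariableChange ℚ), C • congruentNumberCurve n = W → BSDp W 2 := by
  intro W _ _ _ _ n hsq h8 hsel hρ hgen C hC
  have h := rankOne_sha_bsdp_two_congruentNumberCurve_of_tyzGenus h12 hGZK hsq h8 hsel hρ hgen
  exact (P2.CornerFTwo.CongruentNumber.analyticRank_eq_one_and_bsdp_two_of_smul hsq
    ⟨h.1, h.2.2.2⟩ hC).2

/-! ## §C CLOSER BY NAME of the leaf `WAllCornerFTwoRamifiedTYZProved` -/

/-- **CLOSER (PROVED-by-name road): the ramified slice on the flag-free TYZ families**, granted — BY NAME —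
Tian–Yuan–Zhang 2017 Thm 1.2 AS PRINTED (`h12`), Tian 2014 Thm 1.3 (`h13`), Rédei–Reichardt (`hR`),
Li–Liu–Tian 2024 Thm 1.2 (`hLLT`), Monsky 1990 Cor 5.15 (2) (`h515`), and Gross–Zagier–Kolyvagin (`hGZK`, used
ONLY by the TYZρ disjunct for the rank; LLT/T5 need `hLLT` [+ `hR`], T7 `h12 h13 hR`, M35 `h12 hR h515`). Case split on
the five-way membership; model transport fact-free.
[cite: TianYuanZhang2017, Thm. 1.2] [cite: Tian2014, Thm. 1.3] [cite: LiLiuTian2024, Thm. 1.2]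
[cite: Monsky1990MockHeegner, Cor. 5.15 (2)] [cite: Miller2011LMS, Def. 1.1] -/
theorem wAllCornerFTwoRamifiedTYZProved_of_facts (h12 : thm12_parity_of_scriptL')
    (h13 : thm13_rank_one_and_sha_odd) (hR : redeiReichardt_fourTwoCard_classGroup)
    (hLLT : thm12_bsd_congruentNumberCurve) (h515 : cor515_rank_eq_one_and_card_selmerGroup_two)
    (hGZK : rank_eq_analyticRank_of_analyticRank_le_one) : WAllCornerFTwoRamifiedTYZProved := by
  intro W _ _ hcm hr _ hmem
  rcases hmem with hW | ⟨k, p, hp, hinj, h4, h5, hG, C, hC⟩ | ⟨k, p, hp, hinj, h7, h1, hG, C, hC⟩ |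
      ⟨p, q, hp, hq, hp3, hq5, C, hC⟩ | ⟨n, hsq, h8, hsel, hρ, hgen, C, hC⟩
  · exact cornerFTwo_congruentFamilyLLT hLLT W hcm hr hW
  · exact cornerFTwo_tianClassFive hLLT hR W hcm hr k p hp hinj h4 h5 hG C hC
  · exact cornerFTwo_tianClassSeven h12 h13 hR W hcm hr k p hp hinj h7 h1 hG C hC
  · exact cornerFTwo_threeFive h12 hR h515 W hcm hr p q hp hq hp3 hq5 C hC
  · exact cornerFTwo_tyzGenusRho h12 hGZK W hcm hr n hsq h8 hsel hρ hgen C hC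

end Summit.BirchSwinnertonDyer.Rank1Residual.WAll.PrintCf2

end
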